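import Mathlib
import HarnessLib
import Summits.ResolutionOfSingularities.ResolutionOfSingularities.Theorems.RadicialJungCleanModelsLens5GradedBasis
import Summits.ResolutionOfSingularities.ResolutionOfSingularities.Theorems.RadicialJungCleanModelsLens5ImmediateValuesCore

/-!
# Route `RadicialJung`, crux `CleanModels` (stmt-15917) — lens 5, THEOREM T step (V): main theorems

Port of `Cruxes/DescentPerfectToAll/Lens5_ImmediateValues.lean` (res-B-lens-5 g9 support workfile), Part 3.
OURS · counted 0. Nothing here proves resolution in characteristic `p`.

Main valuation-theoretic results: `exists_valuation_eq_pthPower_of_noBestApprox` (from `hdefect` alone, every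
non-zero element of `K^p(g_0)` has the value of a `p`-th power) and `exists_subfield_immediate_values` (packaging).
-/

noncomputable section

set_option linter.dupNamespace false

open Module
open Summit.ResolutionOfSingularities.ResolutionOfSingularities.Theorems.RadicialJung.CleanModels.Lens5.GradedBasis
open Summit.ResolutionOfSingularities.ResolutionOfSingularities.Theorems.RadicialJung.CleanModels.Lens5.ImmediateValues

namespace Summit.ResolutionOfSingularities.ResolutionOfSingularities.Theorems.RadicialJung.CleanModels.Lens5.ImmediateValues

variable {K : Type} [Field K] {Γ₀ : Type} [LinearOrderedCommGroupWithZero Γ₀]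

/-- **Bezout on values.** If `v (m ^ n) = v (w ^ p)` with `0 < n < p` and `p` prime, then `v m` is the value of a
`p`-th power (`n s = p t + 1` gives `v m = v ((w^s / m^t)^p)`). [folklore] -/
theorem exists_valuation_eq_pow_of_pow_eq {p : ℕ} (hp : p.Prime) (v : Valuation K Γ₀) {m w : K} (hm : m ≠ 0) (hw : w ≠ 0)
    {n : ℕ} (hn0 : 0 < n) (hnp : n < p) (h : v (m ^ n) = v (w ^ p)) :
    ∃ z : K, z ≠ 0 ∧ v m = v (z ^ p) := by
  have hcop : Nat.Coprime n p := (Nat.coprime_of_lt_prime hn0.ne' hnp hp).symm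
  obtain ⟨s, -, hs⟩ := Nat.exists_mul_mod_eq_one_of_coprime hcop hp.one_lt
  have hns : n * s = p * (n * s / p) + 1 := by
    have h1 := Nat.div_add_mod (n * s) p
    rw [hs] at h1
    exact h1.symm
  set t := n * s / p with ht
  refine ⟨w ^ s / m ^ t, div_ne_zero (pow_ne_zero _ hw) (pow_ne_zero _ hm), ?_⟩
  have h1 : v (m ^ (n * s)) = v ((w ^ s) ^ p) := by
    rw [pow_mul, map_pow, h, ← map_pow, ← pow_mul, ← pow_mul, mul_comm]
  rw [hns, pow_succ, pow_mul', map_mul, map_pow] at h1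
  have hvmt : v (m ^ t) ^ p ≠ 0 := pow_ne_zero _ ((Valuation.ne_zero_iff v).mpr (pow_ne_zero _ hm))
  rw [div_pow, map_div₀, map_pow v (m ^ t), eq_div_iff hvmt, mul_comm]
  exact h1

/-- **Graded powers.** If `v m` is NOT the value of a `p`-th power (`p` prime, `m ≠ 0`), then
`v (α^p m^i) ≠ v (α'^p m^j)` for `i < j < p` and `α, α' ≠ 0`. [folklore] -/
theorem valuation_pthPower_mul_pow_ne {p : ℕ} (hp : p.Prime) (v : Valuation K Γ₀) {m : K} (hm : m ≠ 0)
    (hnot : ∀ z : K, z ≠ 0 → v m ≠ v (z ^ p)) {i j : ℕ} (hij : i < j) (hj : j < p)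
    {α α' : K} (hα : α ≠ 0) (hα' : α' ≠ 0) : v (α ^ p * m ^ i) ≠ v (α' ^ p * m ^ j) := by
  intro heq
  obtain ⟨k, rfl⟩ := Nat.exists_eq_add_of_le hij.le
  have hk0 : 0 < k := by omega
  have hkp : k < p := by omega
  rw [pow_add, map_mul, map_mul, map_mul] at heq
  have hvα' : v (α' ^ p) ≠ 0 := (Valuation.ne_zero_iff v).mpr (pow_ne_zero _ hα')
  have hvmi : v (m ^ i) ≠ 0 := (Valuation.ne_zero_iff v).mpr (pow_ne_zero _ hm)
  have key : v (m ^ k) = v ((α / α') ^ p) := by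
    rw [div_pow, map_div₀, eq_div_iff hvα']
    apply mul_right_cancel₀ hvmi
    calc v (m ^ k) * v (α' ^ p) * v (m ^ i) = v (α' ^ p) * (v (m ^ i) * v (m ^ k)) := by
            rw [mul_comm (v (m ^ k)) (v (α' ^ p)), mul_assoc, mul_comm (v (m ^ k)) (v (m ^ i))]
      _ = v (α ^ p) * v (m ^ i) := heq.symm
  obtain ⟨z, hz0, hz⟩ := exists_valuation_eq_pow_of_pow_eq hp v hm (div_ne_zero hα hα') hk0 hkp key
  exact hnot z hz0 hz

/-- **(V) inside `K`.** If `g₀` has NO best `p`-th power approximation (`hdefect`), then every non-zero element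
`m = ∑_{j<p} c_j^p g₀^j` of the `K^p`-line `K^p(g₀)` has the value of a `p`-th power: `v m = v (z^p)`. [folklore] -/
theorem exists_valuation_eq_pthPower_of_noBestApprox {p : ℕ} [hp : Fact p.Prime] [CharP K p] (v : Valuation K Γ₀) (g₀ : K)
    (hdefect : ∀ f₀ : K, ∃ f₁ : K, v (g₀ - f₁ ^ p) < v (g₀ - f₀ ^ p))
    (c : Fin p → K) (hm0 : ∑ j, c j ^ p * g₀ ^ (j : ℕ) ≠ 0) :
    ∃ z : K, z ≠ 0 ∧ v (∑ j, c j ^ p * g₀ ^ (j : ℕ)) = v (z ^ p) := by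
  have hpp : p.Prime := hp.out
  set m := ∑ j, c j ^ p * g₀ ^ (j : ℕ) with hm_def
  by_contra H
  push Not at H
  set F : Subfield K := (frobenius K p).fieldRange with hF_def
  have hpowF : ∀ x : K, x ^ p ∈ F := fun x => RingHom.mem_fieldRange.mpr ⟨x, frobenius_def p x⟩
  have hFpow : ∀ a : K, a ∈ F → ∃ α : K, α ^ p = a := fun a ha => by
    obtain ⟨α, hα⟩ := RingHom.mem_fieldRange.mp ha
    exact ⟨α, by rw [← hα, frobenius_def]⟩
  have hpair : ∀ i j : Fin p, i ≠ j → ∀ a a' : K, a ∈ F → a' ∈ F → a ≠ 0 → a' ≠ 0 →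
      v (a * m ^ (i : ℕ)) ≠ v (a' * m ^ (j : ℕ)) := by
    intro i j hij a a' ha ha' ha0 ha'0
    obtain ⟨α, rfl⟩ := hFpow a ha
    obtain ⟨α', rfl⟩ := hFpow a' ha'
    have hα : α ≠ 0 := fun h0 => ha0 (by rw [h0, zero_pow hpp.ne_zero])
    have hα' : α' ≠ 0 := fun h0 => ha'0 (by rw [h0, zero_pow hpp.ne_zero])
    have hij' : (i : ℕ) ≠ (j : ℕ) := Fin.val_ne_of_ne hij
    rcases Nat.lt_or_gt_of_ne hij' with hlt | hlt
    · exact valuation_pthPower_mul_pow_ne hpp v hm0 H hlt j.2 hα hα'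
    · exact fun heq => valuation_pthPower_mul_pow_ne hpp v hm0 H hlt i.2 hα' hα heq.symm
  have hLI : LinearIndependent F (fun i : Fin p => m ^ (i : ℕ)) :=
    linearIndependent_of_valuation_pairwise v F (fun i : Fin p => m ^ (i : ℕ)) (fun i => pow_ne_zero _ hm0) hpair
  set V : Submodule F K := Submodule.span F (Set.range fun j : Fin p => g₀ ^ (j : ℕ)) with hV_def
  haveI : Module.Finite F V := Module.Finite.span_of_finite F (Set.finite_range _)
  have hVfin : finrank F V ≤ p := finrank_span_powers_le g₀
  have hg₀V : g₀ ∈ V := self_mem_span_powers g₀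
  have hmV : m ∈ V := (mem_span_powers_iff g₀ m).mpr ⟨c, rfl⟩
  have hmpow : ∀ n : ℕ, m ^ n ∈ V := by
    intro n
    induction n with
    | zero => simpa using one_mem_span_powers (p := p) g₀
    | succ n ih => rw [pow_succ]; exact mul_mem_span_powers g₀ ih hmV
  set b : Fin p → V := fun i => ⟨m ^ (i : ℕ), hmpow i⟩ with hb_def
  have hbLI : LinearIndependent F b := by apply LinearIndependent.of_comp V.subtype; exact hLI
  have hcard : Fintype.card (Fin p) = finrank F V :=
    le_antisymm (hbLI.fintype_card_le_finrank) (by simpa using hVfin)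
  haveI : Nonempty (Fin p) := ⟨⟨0, hpp.pos⟩⟩
  have hspan : Submodule.span F (Set.range b) = ⊤ := hbLI.span_eq_top_of_card_eq_finrank hcard
  have hg₀span : (⟨g₀, hg₀V⟩ : V) ∈ Submodule.span F (Set.range b) := by rw [hspan]; exact Submodule.mem_top
  obtain ⟨a, ha⟩ := (Submodule.mem_span_range_iff_exists_fun F).mp hg₀span
  have haK : ∑ i, (a i : K) * m ^ (i : ℕ) = g₀ := by have := congrArg Subtype.val ha; simpa [hb_def, Subfield.smul_def] using this
  set j0 : Fin p := ⟨0, hpp.pos⟩ with hj0_def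
  obtain ⟨α₀, hα₀⟩ := hFpow (a j0) (a j0).2
  set T := ∑ i ∈ (Finset.univ : Finset (Fin p)).erase j0, (a i : K) * m ^ (i : ℕ) with hT_def
  have hgT : g₀ - α₀ ^ p = T := by
    rw [← haK, ← Finset.add_sum_erase Finset.univ (fun i => (a i : K) * m ^ (i : ℕ)) (Finset.mem_univ j0), hα₀]
    simp [hj0_def, hT_def]
  have hbound : ∀ f : K, v T ≤ v (g₀ - f ^ p) := by
    intro f
    let a' : Fin p → K := fun i => if i = j0 then (α₀ - f) ^ p else (a i : K)
    have ha'F : ∀ i, a' i ∈ F := by intro i; by_cases hi : i = j0 <;> simp only [a', hi, if_true, if_false]; exact hpowF _; exact (a i).2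
    have hpw : ∀ i ∈ (Finset.univ : Finset (Fin p)), ∀ j ∈ (Finset.univ : Finset (Fin p)), i ≠ j →
        a' i * m ^ (i : ℕ) ≠ 0 → v (a' i * m ^ (i : ℕ)) ≠ v (a' j * m ^ (j : ℕ)) := by
      intro i _ j _ hij hi0
      have hai : a' i ≠ 0 := fun h0 => hi0 (by rw [h0, zero_mul])
      by_cases haj : a' j = 0
      · rw [haj, zero_mul, map_zero]; exact (Valuation.ne_zero_iff v).mpr hi0
      · exact hpair i j hij (a' i) (a' j) (ha'F i) (ha'F j) hai haj
    have hpw' : ∀ i ∈ (Finset.univ : Finset (Fin p)).erase j0, ∀ j ∈ (Finset.univ : Finset (Fin p)).erase j0, i ≠ j →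
        a' i * m ^ (i : ℕ) ≠ 0 → v (a' i * m ^ (i : ℕ)) ≠ v (a' j * m ^ (j : ℕ)) :=
      fun i _ j _ hij hi0 => hpw i (Finset.mem_univ i) j (Finset.mem_univ j) hij hi0
    have hTsum : T = ∑ i ∈ (Finset.univ : Finset (Fin p)).erase j0, a' i * m ^ (i : ℕ) := by
      refine Finset.sum_congr rfl fun i hi => ?_; have hij : i ≠ j0 := Finset.ne_of_mem_erase hi; simp only [a', hij, if_false]
    have hdiff : g₀ - f ^ p = ∑ i, a' i * m ^ (i : ℕ) := by
      rw [← Finset.add_sum_erase Finset.univ (fun i => a' i * m ^ (i : ℕ)) (Finset.mem_univ j0), ← hTsum, ← hgT]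
      simp only [a', if_true, hj0_def]; rw [sub_pow_char]; ring
    rw [hdiff, hTsum, valuation_sum_eq_sup_of_pairwise v _ _ hpw, valuation_sum_eq_sup_of_pairwise v _ _ hpw']
    exact Finset.sup_mono (Finset.erase_subset j0 Finset.univ)
  obtain ⟨f₁, hf₁⟩ := hdefect α₀
  rw [hgT] at hf₁
  exact absurd (hbound f₁) (not_le.mpr hf₁)

/-- **(V), packaged.** Under `hdefect` the subfield `M = K^p(g₀)` satisfies `v(M^×) ⊆ v((K^×)^p)`. [folklore] -/
theorem exists_subfield_immediate_values {p : ℕ} [hp : Fact p.Prime] [CharP K p] (v : Valuation K Γ₀) (g₀ : K)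
    (hdefect : ∀ f₀ : K, ∃ f₁ : K, v (g₀ - f₁ ^ p) < v (g₀ - f₀ ^ p)) :
    ∃ M : Subfield K, (∀ x : K, x ∈ M ↔ ∃ c : Fin p → K, ∑ j, c j ^ p * g₀ ^ (j : ℕ) = x) ∧ g₀ ∈ M ∧
      (∀ x : K, x ^ p ∈ M) ∧ ∀ m : K, m ∈ M → m ≠ 0 → ∃ z : K, z ≠ 0 ∧ v m = v (z ^ p) := by
  obtain ⟨M, hM⟩ := exists_subfield_pthPowers_adjoin (p := p) g₀
  refine ⟨M, hM, ?_, ?_, ?_⟩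
  · rw [hM, ← mem_span_powers_iff]; exact self_mem_span_powers g₀
  · intro x; rw [hM, ← mem_span_powers_iff]
    have : x ^ p = (⟨x ^ p, pow_mem_fieldRange_frobenius x⟩ : (frobenius K p).fieldRange) • (1 : K) := by
      rw [Subfield.smul_def, smul_eq_mul, mul_one]
    rw [this]; exact Submodule.smul_mem _ _ (one_mem_span_powers g₀)
  · intro m hm hm0; obtain ⟨c, rfl⟩ := (hM m).mp hm; exact exists_valuation_eq_pthPower_of_noBestApprox v g₀ hdefect c hm0

end Summit.ResolutionOfSingularities.ResolutionOfSingularities.Theorems.RadicialJung.CleanModels.Lens5.ImmediateValues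

end
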